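import Literature.Computability.Cryptography.LWEPrimePowerProgHist
import Literature.Computability.Cryptography.LWEPrimePowerStrategy
import HarnessLib

/-!
# The Micciancio–Peikert machine, V′: the list-level history readers ARE the strategy's

Topic `Computability/Cryptography` (LWE), grouping namespace `LWE.MP12.Prog`, bridge between
`LWEPrimePowerProgHist.lean` and `LWEPrimePowerStrategy.lean`. Proved material (no named fact)
towards `Literature.Computability.Cryptography.blprs_gapSVP_sqrt_dim_to_lwe_classical` (**pqc.S21**),
hypothesis `h₂`: with accuracy `γ = 1/G` (`G ≥ 1`), **`stepOfL_eq`** (the first argmax of the count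
gaps is the selected step `stepOf`), **`stepVerdL_eq`** (the list-level candidate verdict is
`stepVerd`), **`LstateL_eq`** (the binary value of the digit bits is the loop state `Lstate`, `p = 2`).

## References

* D. Micciancio, C. Peikert, *Trapdoors for lattices: simpler, tighter, faster, smaller*, EUROCRYPT 2012,
  LNCS 7237; full version IACR ePrint 2011/501, §3, Thm. 3.1 proof (pp. 15–16). [MicciancioPeikert2012]
-/

noncomputable section

namespace Literature.Computability.Cryptography

namespace LWE

namespace MP12

namespace Prog

open _root_.Computability Literature.Computability.Complexity Finset

/-! ### Counts -/

/-- `countTrue` of a map over `List.range` is the number of accepted indices. [folklore] -/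
theorem countTrue_map_range (len : ℕ) (f : ℕ → Bool) :
    countTrue ((List.range len).map f) = ∑ i ∈ Finset.range len, (if f i then 1 else 0) := by
  induction len with
  | zero => simp [countTrue_eq]
  | succ len ih =>
    rw [List.range_succ, List.map_append, countTrue_eq, List.count_append, ← countTrue_eq, ih, Finset.sum_range_succ]
    cases h : f len <;> simp [h]

/-- **The list-level count is the real count `cnt` of the strategy.** [folklore] -/
theorem cntL_eq (bits : List Bool) (off len : ℕ) :
    (cntL bits off len : ℝ) = cnt fun b : Fin len => bitAt bits (off + b.val) := by
  rw [cntL, bitsAtL, countTrue_map_range, cnt, Nat.cast_sum, ← Fin.sum_univ_eq_sum_range]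
  refine Finset.sum_congr rfl fun b _ => ?_
  simp only [bitAt]
  split_ifs <;> simp

/-- The count distance as a real absolute value. [folklore] -/
theorem cdist_cast (a b : ℕ) : (cdist a b : ℝ) = |(a : ℝ) - b| := by
  rw [cdist, Nat.cast_natAbs, Int.cast_abs]
  push_cast
  ring_nf

/-! ### The selected step -/

section Step

variable (e N' : ℕ) (bits : List Bool)

/-- The empirical gap of step `i < e` is the `i`-th list gap over `N'`. [folklore] -/
theorem abs_gapHatN_eq (i : ℕ) (hi : i < e) :
    |gapHatN e N' (estBits (e := e) (N' := N') bits) i| = ((gapsL bits e N').getD i 0 : ℝ) / N' := by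
  have hget : (gapsL bits e N').getD i 0 = cdist (cntL bits (i * N') N') (cntL bits ((i + 1) * N') N') := by
    rw [gapsL, List.getD_eq_getElem _ _ (by simpa using hi)]
    simp
  rw [hget, cdist_cast, gapHatN, pHatN, pHatN, dif_pos (by omega), dif_pos (by omega), cntL_eq, cntL_eq, ← sub_div, abs_div,
    Nat.abs_cast]
  congr 2
  · congr 1
    · unfold cnt estBits
      refine Finset.sum_congr rfl fun k _ => ?_
      rw [finProdFinEquiv_apply_val, Nat.add_comm, Nat.mul_comm]
    · unfold cnt estBits
      refine Finset.sum_congr rfl fun k _ => ?_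
      rw [finProdFinEquiv_apply_val, Nat.add_comm, Nat.mul_comm]

/-- The list gaps vanish when `N' = 0`. [folklore] -/
theorem gapsL_getD_of_zero (hN : N' = 0) (i : ℕ) : (gapsL bits e N').getD i 0 = 0 := by
  subst hN
  by_cases hi : i < e
  · rw [gapsL, List.getD_eq_getElem _ _ (by simpa using hi)]
    simp [cdist, cntL, bitsAtL, countTrue_eq]
  · rw [List.getD_eq_default _ _ (by simpa [gapsL] using Nat.not_lt.1 hi)]

/-- **The list-level selected step is the strategy's selected step.** [cite: MicciancioPeikert2012, Thm. 3.1 proof (p. 15)] -/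
theorem stepOfL_eq : stepOfL bits e N' = stepOf e N' bits := by
  classical
  rw [stepOf, selectStep, stepOfL]
  rcases Nat.eq_zero_or_pos e with he | he
  · subst he
    have hno : ¬∃ i, IsMaxStep 0 N' (estBits (e := 0) (N' := N') bits) i := fun ⟨i, hi, _⟩ => Nat.not_lt_zero _ hi
    rw [dif_neg hno]
    rfl
  have hex := exists_isMaxStep e N' he (estBits (e := e) (N' := N') bits)
  rw [dif_pos hex]
  set l := gapsL bits e N' with hl
  have hlen : l.length = e := by simp [hl, gapsL]
  have hne : l ≠ [] := fun h => by rw [h] at hlen; simp at hlen; omega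
  obtain ⟨ha, hmax, hlt⟩ := firstArgmax_spec hne
  rw [hlen] at ha hmax
  symm
  rw [Nat.find_eq_iff]
  refine ⟨⟨ha, fun i' hi' => ?_⟩, fun i hi hmaxi => ?_⟩
  · rw [abs_gapHatN_eq e N' bits i' hi', abs_gapHatN_eq e N' bits _ ha]
    exact div_le_div_of_nonneg_right (by exact_mod_cast hmax i' hi') (Nat.cast_nonneg _)
  · -- an earlier step has a strictly smaller gap
    have h1 := hlt i hi
    rcases Nat.eq_zero_or_pos N' with hN | hN
    · rw [gapsL_getD_of_zero e N' bits hN, gapsL_getD_of_zero e N' bits hN] at h1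
      exact Nat.lt_irrefl _ h1
    · have h2 := hmaxi.2 _ ha
      rw [abs_gapHatN_eq e N' bits _ ha, abs_gapHatN_eq e N' bits i hmaxi.1,
        div_le_div_iff_of_pos_right (by exact_mod_cast hN)] at h2
      exact absurd (by exact_mod_cast h2) (Nat.not_le.2 h1)

end Step

/-! ### The candidate verdicts and the loop state -/

section Verd

variable (d e T N N' G : ℕ) (bits : List Bool)

/-- The genuine history parameters. [folklore] -/
def Hof : HPrm := (e, (T, (N, (G, nEst e N'))))

variable {d e T N N' G}

/-- The position of the digit bit. [folklore] -/
theorem digBase_eq (c : Fin d) (i' : Fin e) (k : Fin 2) (t : Fin T) (h : Fin 2) (b : Fin N) :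
    nEst e N' + (digEquiv d e 2 T N (c, (i', (k, (t, (h, b)))))).val = digBase (Hof e T N N' G) c.val i'.val k.val t.val + (h.val * N + b.val) := by
  rw [val_digEquiv, digBase, Hof]
  simp only
  ring

/-- **The list-level candidate verdict is the strategy's** (`γ = 1/G`, `G ≥ 1`). [cite: MicciancioPeikert2012, Thm. 3.1 proof (p. 16)] -/
theorem stepVerdL_eq (hG : 1 ≤ G) (c : Fin d) (i' : Fin e) (k : Fin 2) :
    stepVerdL bits (Hof e T N N' G) T c.val i'.val k.val = stepVerd (p := 2) (N := N) (T := T) (N' := N') (1 / (G : ℝ)) bits c i' k := by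
  classical
  rw [stepVerd, stepVerdL]
  have hG0 : (0 : ℝ) < G := by exact_mod_cast hG
  -- one trial
  have htrial : ∀ t : Fin T, trialOkL bits (Hof e T N N' G) (digBase (Hof e T N N' G) c.val i'.val k.val t.val) = true ↔
      trialSays0 N (1 / (G : ℝ)) ((fun b : Fin N => digBit (e := e) (N' := N') bits (c, (i', (k, (t, (0, b)))))),
        (fun b : Fin N => digBit (e := e) (N' := N') bits (c, (i', (k, (t, (1, b))))))) := by
    intro t
    rw [trialOkL, decide_eq_true_iff, trialSays0]
    show N ≤ 2 * G * cdist (cntL bits (digBase (Hof e T N N' G) c.val i'.val k.val t.val) N)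
      (cntL bits (digBase (Hof e T N N' G) c.val i'.val k.val t.val + N) N) ↔ _
    set cd := cdist (cntL bits (digBase (Hof e T N N' G) c.val i'.val k.val t.val) N) (cntL bits (digBase (Hof e T N N' G) c.val i'.val k.val t.val + N) N)
      with hcd
    have hx : cnt (fun b : Fin N => digBit (e := e) (N' := N') bits (c, (i', (k, (t, (0, b)))))) = cntL bits (digBase (Hof e T N N' G) c.val i'.val k.val t.val) N := by
      rw [cntL_eq]; unfold cnt digBit; refine Finset.sum_congr rfl fun b _ => ?_
      simp only [digBase_eq (N' := N') (G := G) c i' k t 0 b, Fin.val_zero, zero_mul, Nat.zero_add]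
    have hy : cnt (fun b : Fin N => digBit (e := e) (N' := N') bits (c, (i', (k, (t, (1, b)))))) = cntL bits (digBase (Hof e T N N' G) c.val i'.val k.val t.val + N) N := by
      rw [cntL_eq]; unfold cnt digBit; refine Finset.sum_congr rfl fun b _ => ?_
      simp only [digBase_eq (N' := N') (G := G) c i' k t 1 b, Fin.val_one, one_mul, Nat.add_assoc]
    rw [hx, hy, ← cdist_cast, ← hcd]
    rw [show (N : ℝ) * (1 / G) / 2 = N / (2 * G) by field_simp, div_le_iff₀ (by positivity)]
    constructor
    · intro h
      have h1 : (N : ℝ) ≤ 2 * G * cd := by exact_mod_cast h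
      linarith
    · intro h
      have h1 : (N : ℝ) ≤ 2 * G * cd := by linarith
      exact_mod_cast h1
  -- some trial
  rw [Bool.eq_iff_iff, decide_eq_true_iff, decide_eq_true_iff, says0, Nat.one_le_iff_ne_zero, ← Nat.pos_iff_ne_zero, countTrue_eq,
    List.count_pos_iff, List.mem_map]
  constructor
  · rintro ⟨t, ht, htrue⟩
    rw [List.mem_range] at ht
    exact ⟨⟨t, ht⟩, (htrial ⟨t, ht⟩).1 htrue⟩
  · rintro ⟨t, ht⟩
    exact ⟨t.val, List.mem_range.2 t.2, (htrial t).2 ht⟩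

/-- `digitOf` for `p = 2`: digit `1` iff candidate `0` is rejected and candidate `1` accepted. [folklore] -/
theorem digitOf_two (v : Fin 2 → Bool) : digitOf v = if (if v 0 then false else v 1) then 1 else 0 := by
  classical
  unfold digitOf
  cases h0 : v 0
  · cases h1 : v 1
    · have hemp : ¬(Finset.univ.filter fun k : Fin 2 => v k = true).Nonempty := by
        rintro ⟨k, hk⟩
        rw [Finset.mem_filter] at hk
        rcases Fin.exists_fin_two.mp ⟨k, rfl⟩ with h | h <;> simp_all
      rw [dif_neg hemp]; simp
    · have hset : (Finset.univ.filter fun k : Fin 2 => v k = true) = {1} := by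
        ext k; rcases Fin.exists_fin_two.mp ⟨k, rfl⟩ with h | h <;> simp_all
      simp [hset]
  · have hmem : (0 : Fin 2) ∈ Finset.univ.filter fun k : Fin 2 => v k = true := by simp [h0]
    have hne : (Finset.univ.filter fun k : Fin 2 => v k = true).Nonempty := ⟨0, hmem⟩
    rw [dif_pos hne]
    have : (Finset.univ.filter fun k : Fin 2 => v k = true).min' hne = 0 :=
      le_antisymm (Finset.min'_le _ _ hmem) (Fin.zero_le _)
    simp [this]

/-- `bitsToNat` of an appended bit. [folklore] -/
theorem bitsToNat_append_singleton : ∀ (l : List Bool) (b : Bool), bitsToNat (l ++ [b]) = bitsToNat l + (if b then 1 else 0) * 2 ^ l.length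
  | [], b => by cases b <;> simp [bitsToNat]
  | a :: l, b => by
    rw [List.cons_append, bitsToNat, bitsToNat_append_singleton l b, bitsToNat, List.length_cons, pow_succ]
    ring

/-- **The list-level loop state is the strategy's loop state** (`p = 2`, `γ = 1/G`). [cite: MicciancioPeikert2012, Thm. 3.1 proof (p. 16)] -/
theorem LstateL_eq (hG : 1 ≤ G) (c : Fin d) : ∀ n : ℕ,
    LstateL bits (Hof e T N N' G) T e c.val n = Lstate (p := 2) (e := e) (N := N) (T := T) (N' := N') (1 / (G : ℝ)) bits c n
  | 0 => by simp [LstateL, Lstate]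
  | n + 1 => by
    rw [Lstate, ← LstateL_eq hG c n, LstateL, LstateL]
    by_cases hn : n < e
    · rw [dif_pos hn, Nat.min_eq_left (by omega), Nat.min_eq_left hn.le, List.range_succ, List.map_append, List.map_singleton,
        bitsToNat_append_singleton, List.length_map, List.length_range, digitOf_two]
      congr 2
      rw [digitBitL]
      have h0 := stepVerdL_eq (T := T) (N := N) (N' := N') bits hG c ⟨n, hn⟩ 0
      have h1 := stepVerdL_eq (T := T) (N := N) (N' := N') bits hG c ⟨n, hn⟩ 1
      simp only [Fin.val_zero, Fin.val_one] at h0 h1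
      rw [h0, h1]
    · rw [dif_neg hn, Nat.min_eq_right (by omega), Nat.min_eq_right (by omega)]

end Verd

end Prog

end MP12

end LWE

end Literature.Computability.Cryptography

end
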